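import Mathlib
import Summits.NavierStokesRegularity.NavierStokesRegularity.Theorems.ClockStretchingLawClockCeilingSingularStretchingNearZero
import HarnessLib

/-!
# Route `ScaledTopAlignment`: the Fatou upgrade for BULK (measure) scaled top-set alignment
# (support for the door W3 = `AprioriScaledTopAlignment`, stmt-NavierStokesRegularity-19901, and p3's
# staged one-item restate W3 → W3′)

Planner p3 (ROUND-3, `HOME/ns-regularity-ideate-p3/BulkAlignment.lean`, kernel rc 0; restate package
`route-ScaledTopAlignment/restate/README.md`) weakens the door W3 = `AprioriScaledTopAlignment` to
W3′ = a-priori scaled **bulk** alignment: instead of every point of the relative top set in the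
diffusion-scaled ball being `ε`-aligned with the centre, the Lebesgue measure of the misaligned part is
`≤ δ ℓ³` (`ℓ = √(ν/|ω(t,x)|)`) for every `δ > 0` once `|ω(t,x)| ≥ M(λ,R,ε,δ)`. The restate is mechanically
blocked by the 12 000-char glue cap unless the Fatou upgrade is a tree theorem (README, order of
operations (1): "prover lands the Fatou lemma as a Theorems support file
`--supports stmt-NavierStokesRegularity-19901`"). This file lands it, with the sine primitive
`sin∠(a,b) = √(1 − ⟪a/|a|, b/|b|⟫²)` written out (no new definitions; normalisation invariance `inv_norm_smul_smul_of_pos` is the tree's):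

* `dirSine_limit_eq_zero_of_scaledBulkAligned` — **the Fatou upgrade** (abstract vorticity family `ω`,
  no Navier–Stokes content): along any zoom `y ↦ (λ_j²/ν) ω(t_j, x_j + λ_j y)` with moving centres,
  `λ_j → 0⁺`, converging pointwise to a CONTINUOUS `Ω`, bulk alignment of the family forces
  `sin∠(Ω y₀, Ω y) = 0` whenever `Ω y₀ ≠ 0 ≠ Ω y` (a misaligned pair opens a ball of misaligned points
  around `y`, contained in `liminf` of the zoomed misaligned sets, whose measure W3′ sends to `0`;
  continuity of measure from below on the increasing tails — no measurability needed — and the exact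
  scaling of Lebesgue measure under the zoom).

The bridge «W3′ + NoTypeII ⇒ Clay (A)» is the sibling file `ScaledTopAlignmentBulkBridge.lean`.
Port of p3's kernel file (proof verbatim up to unfolding `sineOf`). WHAT THIS IS NOT: not NS regularity.
-/

noncomputable section

-- the summit and its single sub-problem share the name (CONVENTIONS §1), as in every Theorems file
set_option linter.dupNamespace false

open Filter Topology MeasureTheory Set

namespace Summit.NavierStokesRegularity.NavierStokesRegularity.Theorems

/-! ### The direction sine `sin∠(a, b) = √(1 − ⟪a/|a|, b/|b|⟫²)` (the route's primitive, written out) -/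

/-- The direction sine is non-negative. [folklore] -/
theorem dirSine_nonneg (a b : EuclideanSpace ℝ (Fin 3)) :
    0 ≤ Real.sqrt (1 - (inner ℝ (‖a‖⁻¹ • a) (‖b‖⁻¹ • b)) ^ 2) :=
  Real.sqrt_nonneg _

/-- The direction sine is invariant under a common positive scaling of both vectors. [folklore] -/
theorem dirSine_smul_pos {c : ℝ} (hc : 0 < c) (a b : EuclideanSpace ℝ (Fin 3)) :
    Real.sqrt (1 - (inner ℝ (‖c • a‖⁻¹ • (c • a)) (‖c • b‖⁻¹ • (c • b))) ^ 2) =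
      Real.sqrt (1 - (inner ℝ (‖a‖⁻¹ • a) (‖b‖⁻¹ • b)) ^ 2) := by
  rw [inv_norm_smul_smul_of_pos hc, inv_norm_smul_smul_of_pos hc]

/-- Continuity of the direction sine at pairs of non-zero vectors, along any filter. [folklore] -/
theorem tendsto_dirSine {α : Type*} {l : Filter α} {f g : α → EuclideanSpace ℝ (Fin 3)}
    {a b : EuclideanSpace ℝ (Fin 3)} (ha : a ≠ 0) (hb : b ≠ 0)
    (hf : Tendsto f l (𝓝 a)) (hg : Tendsto g l (𝓝 b)) :
    Tendsto (fun i => Real.sqrt (1 - (inner ℝ (‖f i‖⁻¹ • f i) (‖g i‖⁻¹ • g i)) ^ 2)) l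
      (𝓝 (Real.sqrt (1 - (inner ℝ (‖a‖⁻¹ • a) (‖b‖⁻¹ • b)) ^ 2))) := by
  -- adapted from NsregP3.Bulk.tendsto_sineOf
  have hnf : Tendsto (fun i => ‖f i‖⁻¹ • f i) l (𝓝 (‖a‖⁻¹ • a)) :=
    ((hf.norm).inv₀ (norm_ne_zero_iff.mpr ha)).smul hf
  have hng : Tendsto (fun i => ‖g i‖⁻¹ • g i) l (𝓝 (‖b‖⁻¹ • b)) :=
    ((hg.norm).inv₀ (norm_ne_zero_iff.mpr hb)).smul hg
  have h : Tendsto (fun i => (1:ℝ) - (inner ℝ (‖f i‖⁻¹ • f i) (‖g i‖⁻¹ • g i)) ^ 2) l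
      (𝓝 ((1:ℝ) - (inner ℝ (‖a‖⁻¹ • a) (‖b‖⁻¹ • b)) ^ 2)) := ((hnf.inner hng).pow 2).const_sub (1:ℝ)
  exact (Real.continuous_sqrt.tendsto _).comp h

/-! ### The Fatou upgrade -/

/-- **The Fatou upgrade for bulk scaled top-set alignment** (abstract vorticity family; planner p3,
ROUND-3). Let `ω : ℝ → ℝ³ → ℝ³` satisfy BULK scaled alignment on `[0, T)`: for all `λ ∈ (0,1)`, `R, ε, δ > 0`
there is `M > 0` such that for `t ∈ [0,T)` and `M ≤ |ω(t,x)|` the set of `y` with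
`λ|ω(t,x)| ≤ |ω(t,y)|`, `|x − y| ≤ R√(ν/|ω(t,x)|)` and `sin∠(ω(t,x), ω(t,y)) > ε` has Lebesgue measure
`≤ δ (√(ν/|ω(t,x)|))³`. Then along any zoom `y ↦ (λ_j²/ν) ω(t_j, x_j + λ_j y)` (moving centres
`x_j`, times `t_j ∈ [0,T)`, scales `λ_j → 0⁺`) converging POINTWISE to a CONTINUOUS `Ω`,
`sin∠(Ω y₀, Ω y) = 0` whenever `Ω y₀ ≠ 0 ≠ Ω y`. Proof: an `ε`-misaligned pair `y₀, y` opens a ball of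
misaligned relative-top points around `y` (continuity), which lies in the increasing union of the tails
`⋂_{j ≥ N} A_j` of the zoom preimages `A_j` of the physical misaligned sets; `vol A_j = λ_j⁻³ vol(phys)
≤ λ_j⁻³ δ ℓ_j³` with `ℓ_j < λ_j K` (the zoomed vorticity at `y₀` stays comparable to `|Ω y₀|`), so a
suitable `δ` makes every tail at most half the ball — contradiction with continuity of measure from
below. [cite: GigaMiura2011, Thm 1.1 (blow-up argument; Commun. Math. Phys. 303 (2011) 289–300)] -/
theorem dirSine_limit_eq_zero_of_scaledBulkAligned {ν T : ℝ} (hν : 0 < ν)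
    {ω : ℝ → EuclideanSpace ℝ (Fin 3) → EuclideanSpace ℝ (Fin 3)}
    (hW : ∀ lam : ℝ, 0 < lam → lam < 1 → ∀ R : ℝ, 0 < R → ∀ ε : ℝ, 0 < ε → ∀ δ : ℝ, 0 < δ →
      ∃ M : ℝ, 0 < M ∧ ∀ t ∈ Set.Ico 0 T, ∀ x : EuclideanSpace ℝ (Fin 3), M ≤ ‖ω t x‖ →
        volume {y : EuclideanSpace ℝ (Fin 3) | lam * ‖ω t x‖ ≤ ‖ω t y‖ ∧
            ‖x - y‖ ≤ R * Real.sqrt (ν / ‖ω t x‖) ∧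
            ε < Real.sqrt (1 - (inner ℝ (‖ω t x‖⁻¹ • ω t x) (‖ω t y‖⁻¹ • ω t y)) ^ 2)}
          ≤ ENNReal.ofReal (δ * Real.sqrt (ν / ‖ω t x‖) ^ 3))
    (xc : ℕ → EuclideanSpace ℝ (Fin 3)) (t : ℕ → ℝ) (ht : ∀ j, t j ∈ Set.Ico 0 T)
    (lam : ℕ → ℝ) (hlam : ∀ j, 0 < lam j) (hlam0 : Tendsto lam atTop (𝓝 0))
    (Ω : EuclideanSpace ℝ (Fin 3) → EuclideanSpace ℝ (Fin 3)) (hΩ : Continuous Ω)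
    (hconv : ∀ y, Tendsto (fun j => (lam j ^ 2 / ν) • ω (t j) (xc j + lam j • y)) atTop (𝓝 (Ω y)))
    (y₀ y : EuclideanSpace ℝ (Fin 3)) (hy₀ : Ω y₀ ≠ 0) (hy : Ω y ≠ 0) :
    Real.sqrt (1 - (inner ℝ (‖Ω y₀‖⁻¹ • Ω y₀) (‖Ω y‖⁻¹ • Ω y)) ^ 2) = 0 := by
  -- adapted from NsregP3.Bulk.sineOf_limit_eq_zero_of_bulk (HOME/ns-regularity-ideate-p3/BulkAlignment.lean,
  -- planner p3 g1, kernel rc 0), `sineOf` written out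
  by_contra hs0
  -- notation and basic positivity
  set w : ℕ → EuclideanSpace ℝ (Fin 3) → EuclideanSpace ℝ (Fin 3) :=
    fun j z => (lam j ^ 2 / ν) • ω (t j) (xc j + lam j • z) with hwdef
  have hconv' : ∀ z, Tendsto (fun j => w j z) atTop (𝓝 (Ω z)) := hconv
  set A := ‖Ω y₀‖ with hAdef
  set B := ‖Ω y‖ with hBdef
  set s := Real.sqrt (1 - (inner ℝ (‖Ω y₀‖⁻¹ • Ω y₀) (‖Ω y‖⁻¹ • Ω y)) ^ 2) with hsdef
  have hA : 0 < A := norm_pos_iff.mpr hy₀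
  have hB : 0 < B := norm_pos_iff.mpr hy
  have hs : 0 < s := lt_of_le_of_ne (dirSine_nonneg _ _) (Ne.symm hs0)
  have hc : ∀ j, 0 < lam j ^ 2 / ν := fun j => div_pos (pow_pos (hlam j) 2) hν
  set lamS := min (1 / 2 : ℝ) (B / (4 * A)) with hlamS
  have hlamS0 : 0 < lamS := lt_min (by norm_num) (by positivity)
  have hlamS1 : lamS < 1 := lt_of_le_of_lt (min_le_left _ _) (by norm_num)
  set RS := (‖y₀ - y‖ + 1) * Real.sqrt (2 * A) + 1 with hRS
  have hRS0 : 0 < RS := by positivity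
  set εS := s / 2 with hεS
  have hεS0 : 0 < εS := by positivity
  -- (a) a ball around `y` on which `Ω` stays in the relative top set and `ε`-misaligned with `Ω y₀`
  have hnear : ∀ᶠ y' in 𝓝 y, B / 2 < ‖Ω y'‖ ∧
      εS < Real.sqrt (1 - (inner ℝ (‖Ω y₀‖⁻¹ • Ω y₀) (‖Ω y'‖⁻¹ • Ω y')) ^ 2) := by
    have hΩy : Tendsto Ω (𝓝 y) (𝓝 (Ω y)) := (hΩ.continuousAt (x := y)).tendsto
    have h1 : Tendsto (fun y' => ‖Ω y'‖) (𝓝 y) (𝓝 B) := hΩy.norm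
    have h2 : Tendsto (fun y' => Real.sqrt (1 - (inner ℝ (‖Ω y₀‖⁻¹ • Ω y₀) (‖Ω y'‖⁻¹ • Ω y')) ^ 2))
        (𝓝 y) (𝓝 s) :=
      tendsto_dirSine hy₀ hy tendsto_const_nhds hΩy
    exact (h1.eventually_const_lt (by linarith)).and (h2.eventually_const_lt (by rw [hεS]; linarith))
  obtain ⟨r, hr, hrP⟩ := Metric.eventually_nhds_iff.mp hnear
  set r' := min r 1 with hr'
  have hr'0 : 0 < r' := lt_min hr one_pos
  -- the physical misaligned sets and their zoom preimages
  set x₀ : ℕ → EuclideanSpace ℝ (Fin 3) := fun j => xc j + lam j • y₀ with hx₀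
  set Phys : ℕ → Set (EuclideanSpace ℝ (Fin 3)) := fun j =>
    {x' : EuclideanSpace ℝ (Fin 3) | lamS * ‖ω (t j) (x₀ j)‖ ≤ ‖ω (t j) x'‖ ∧
      ‖x₀ j - x'‖ ≤ RS * Real.sqrt (ν / ‖ω (t j) (x₀ j)‖) ∧
      εS < Real.sqrt (1 - (inner ℝ (‖ω (t j) (x₀ j)‖⁻¹ • ω (t j) (x₀ j))
        (‖ω (t j) x'‖⁻¹ • ω (t j) x')) ^ 2)} with hPhys
  set Aset : ℕ → Set (EuclideanSpace ℝ (Fin 3)) := fun j =>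
    {y' : EuclideanSpace ℝ (Fin 3) | xc j + lam j • y' ∈ Phys j} with hAset
  -- (b) every point of the ball lies in `Aset j` for all large `j`
  have e1 : ∀ᶠ j in atTop, ‖w j y₀‖ < 2 * A := (hconv' y₀).norm.eventually_lt_const (by linarith)
  have e2 : ∀ᶠ j in atTop, A / 2 < ‖w j y₀‖ := (hconv' y₀).norm.eventually_const_lt (by linarith)
  have hmem : ∀ y' : EuclideanSpace ℝ (Fin 3), dist y' y < r' → ∀ᶠ j in atTop, y' ∈ Aset j := by
    intro y' hy'
    have hP := hrP (lt_of_lt_of_le hy' (min_le_left _ _))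
    have hy'1 : dist y' y < 1 := lt_of_lt_of_le hy' (min_le_right _ _)
    have hΩy' : Ω y' ≠ 0 := by
      intro h; rw [h, norm_zero] at hP; linarith [hP.1]
    have e3 : ∀ᶠ j in atTop, B / 2 < ‖w j y'‖ := (hconv' y').norm.eventually_const_lt hP.1
    have e4 : ∀ᶠ j in atTop,
        εS < Real.sqrt (1 - (inner ℝ (‖w j y₀‖⁻¹ • w j y₀) (‖w j y'‖⁻¹ • w j y')) ^ 2) :=
      (tendsto_dirSine hy₀ hΩy' (hconv' y₀) (hconv' y')).eventually_const_lt hP.2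
    filter_upwards [e1, e2, e3, e4] with j h1 h2 h3 h4
    set c := lam j ^ 2 / ν with hcdef
    have hcj : 0 < c := hc j
    set a := ω (t j) (x₀ j) with hadef
    set b := ω (t j) (xc j + lam j • y') with hbdef
    have hwa : w j y₀ = c • a := rfl
    have hwb : w j y' = c • b := rfl
    have hna : ‖w j y₀‖ = c * ‖a‖ := by rw [hwa, norm_smul, Real.norm_of_nonneg hcj.le]
    have hnb : ‖w j y'‖ = c * ‖b‖ := by rw [hwb, norm_smul, Real.norm_of_nonneg hcj.le]
    show xc j + lam j • y' ∈ Phys j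
    refine ⟨?_, ?_, ?_⟩
    · -- relative top set
      have : lamS * (c * ‖a‖) ≤ c * ‖b‖ := by
        rw [← hna, ← hnb]
        have hl : lamS ≤ B / (4 * A) := min_le_right _ _
        have : lamS * ‖w j y₀‖ ≤ B / (4 * A) * (2 * A) :=
          mul_le_mul hl h1.le (norm_nonneg _) (by positivity)
        have h' : B / (4 * A) * (2 * A) = B / 2 := by field_simp; ring
        linarith [h3]
      have h'' : c * (lamS * ‖a‖) ≤ c * ‖b‖ := by linarith [this]
      exact le_of_mul_le_mul_left h'' hcj
    · -- inside the scaled ball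
      have hxy : x₀ j - (xc j + lam j • y') = lam j • (y₀ - y') := by
        show (xc j + lam j • y₀) - (xc j + lam j • y') = lam j • (y₀ - y')
        rw [smul_sub]; abel
      rw [hxy, norm_smul, Real.norm_of_nonneg (hlam j).le]
      have hapos : 0 < ‖a‖ := by
        have h0 : 0 < c * ‖a‖ := by rw [← hna]; linarith [h2]
        rcases (norm_nonneg a).lt_or_eq with hp | hz
        · exact hp
        · rw [← hz, mul_zero] at h0; exact absurd h0 (lt_irrefl 0)
      have hq : lam j ^ 2 / (2 * A) ≤ ν / ‖a‖ := by
        rw [div_le_div_iff₀ (by positivity) hapos]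
        have ha2 : c * ‖a‖ < 2 * A := by rw [← hna]; exact h1
        rw [hcdef] at ha2
        have : lam j ^ 2 * ‖a‖ < 2 * A * ν := by
          have := (div_mul_eq_mul_div (lam j ^ 2) ν ‖a‖).symm ▸ ha2
          rwa [div_lt_iff₀ hν] at this
        linarith
      have hsq : lam j / Real.sqrt (2 * A) ≤ Real.sqrt (ν / ‖a‖) := by
        have : Real.sqrt (lam j ^ 2 / (2 * A)) = lam j / Real.sqrt (2 * A) := by
          rw [Real.sqrt_div' _, Real.sqrt_sq (hlam j).le]
          positivity
        rw [← this]; exact Real.sqrt_le_sqrt hq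
      have hs2A : 0 < Real.sqrt (2 * A) := Real.sqrt_pos.mpr (by linarith)
      have hdist' : ‖y₀ - y'‖ < ‖y₀ - y‖ + 1 := by
        have : dist y₀ y' ≤ dist y₀ y + dist y y' := dist_triangle _ _ _
        rw [dist_comm y y'] at this
        rw [← dist_eq_norm, ← dist_eq_norm]; linarith
      calc lam j * ‖y₀ - y'‖ = (lam j / Real.sqrt (2 * A)) * (‖y₀ - y'‖ * Real.sqrt (2 * A)) := by
            field_simp
        _ ≤ Real.sqrt (ν / ‖a‖) * (‖y₀ - y'‖ * Real.sqrt (2 * A)) :=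
            mul_le_mul_of_nonneg_right hsq (by positivity)
        _ ≤ Real.sqrt (ν / ‖a‖) * RS := by
            apply mul_le_mul_of_nonneg_left _ (Real.sqrt_nonneg _)
            rw [hRS]
            have : ‖y₀ - y'‖ * Real.sqrt (2 * A) ≤ (‖y₀ - y‖ + 1) * Real.sqrt (2 * A) :=
              mul_le_mul_of_nonneg_right hdist'.le hs2A.le
            linarith
        _ = RS * Real.sqrt (ν / ‖a‖) := mul_comm _ _
    · -- misaligned
      rw [← dirSine_smul_pos hcj a b, ← hwa, ← hwb]; exact h4
  -- (c) the ball lies in the increasing union of the tails `⋂_{j ≥ N} Aset j`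
  set Tail : ℕ → Set (EuclideanSpace ℝ (Fin 3)) := fun N => ⋂ j, ⋂ (_ : N ≤ j), Aset j with hTail
  have hTailmono : Monotone Tail := by
    intro N N' hNN' z hz
    simp only [hTail, mem_iInter] at hz ⊢
    exact fun j hj => hz j (le_trans hNN' hj)
  have hball : Metric.ball y r' ⊆ ⋃ N, Tail N := by
    intro y' hy'
    obtain ⟨N, hN⟩ := eventually_atTop.mp (hmem y' (Metric.mem_ball.mp hy'))
    exact mem_iUnion.mpr ⟨N, mem_iInter.mpr fun j => mem_iInter.mpr fun hj => hN j hj⟩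
  -- (d) measure bookkeeping
  set V := volume (Metric.ball y r') with hV
  have hVpos : 0 < V := Metric.measure_ball_pos volume y hr'0
  have hVtop : V ≠ ⊤ := (measure_ball_lt_top).ne
  have hVreal : 0 < V.toReal := ENNReal.toReal_pos hVpos.ne' hVtop
  set K := Real.sqrt (2 / A) with hK
  have hKpos : 0 < K := Real.sqrt_pos.mpr (by positivity)
  set δ := V.toReal / (2 * K ^ 3) with hδ
  have hδ0 : 0 < δ := by positivity
  obtain ⟨M, hM0, hM⟩ := hW lamS hlamS0 hlamS1 RS hRS0 εS hεS0 δ hδ0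
  have e5 : ∀ᶠ j in atTop, lam j < Real.sqrt (A * ν / (2 * M)) :=
    hlam0.eventually_lt_const (Real.sqrt_pos.mpr (by positivity))
  obtain ⟨N₀, hN₀⟩ := eventually_atTop.mp ((e1.and e2).and e5)
  -- measure of one zoomed misaligned set, for j ≥ N₀
  have hAj : ∀ j, N₀ ≤ j → volume (Aset j) ≤ ENNReal.ofReal (V.toReal / 2) := by
    intro j hj
    obtain ⟨⟨h1, h2⟩, h5⟩ := hN₀ j hj
    set c := lam j ^ 2 / ν with hcdef
    have hcj : 0 < c := hc j
    set a := ω (t j) (x₀ j) with hadef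
    have hna : ‖w j y₀‖ = c * ‖a‖ := by
      show ‖(lam j ^ 2 / ν) • ω (t j) (xc j + lam j • y₀)‖ = c * ‖a‖
      rw [norm_smul, Real.norm_of_nonneg hcj.le]
    rw [hna] at h1 h2
    -- threshold `M ≤ ‖a‖`
    have hlam2 : lam j ^ 2 < A * ν / (2 * M) := by
      have h0 : 0 ≤ lam j := (hlam j).le
      calc lam j ^ 2 = lam j * lam j := by ring
        _ < Real.sqrt (A * ν / (2 * M)) * Real.sqrt (A * ν / (2 * M)) := mul_lt_mul'' h5 h5 h0 h0
        _ = A * ν / (2 * M) := Real.mul_self_sqrt (by positivity)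
    have hcle' : c ≤ A / (2 * M) := by
      rw [hcdef, div_le_iff₀ hν]
      have hr : A / (2 * M) * ν = A * ν / (2 * M) := by ring
      rw [hr]; exact hlam2.le
    have hMa : M ≤ ‖a‖ := by
      have hapos : 0 ≤ ‖a‖ := norm_nonneg _
      have h6 : A / 2 < A / (2 * M) * ‖a‖ := lt_of_lt_of_le h2 (mul_le_mul_of_nonneg_right hcle' hapos)
      have h7 : M * (A / 2) < M * (A / (2 * M) * ‖a‖) := mul_lt_mul_of_pos_left h6 hM0
      have hsimp : M * (A / (2 * M) * ‖a‖) = A / 2 * ‖a‖ := by field_simp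
      rw [hsimp] at h7
      have hA2 : 0 < A / 2 := by linarith
      nlinarith
    have hapos : 0 < ‖a‖ := lt_of_lt_of_le hM0 hMa
    -- bulk alignment at the physical centre `x₀ j`
    have hphys : volume (Phys j) ≤ ENNReal.ofReal (δ * Real.sqrt (ν / ‖a‖) ^ 3) :=
      hM (t j) (ht j) (x₀ j) hMa
    -- exact scaling of Lebesgue measure under the zoom `y' ↦ xc j + lam j • y'`
    have hpre : Aset j = (fun y' : EuclideanSpace ℝ (Fin 3) => lam j • y') ⁻¹'
        ((fun z : EuclideanSpace ℝ (Fin 3) => xc j + z) ⁻¹' Phys j) := rfl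
    have hvolA : volume (Aset j) = ENNReal.ofReal ((lam j ^ 3)⁻¹) * volume (Phys j) := by
      rw [hpre, Measure.addHaar_preimage_smul volume (hlam j).ne', finrank_euclideanSpace_fin,
        measure_preimage_add, abs_of_pos (inv_pos.mpr (pow_pos (hlam j) 3))]
    -- `√(ν/‖a‖) < lam j · K`
    have hsqrt : Real.sqrt (ν / ‖a‖) < lam j * K := by
      have hq : ν / ‖a‖ < lam j ^ 2 * (2 / A) := by
        rw [div_lt_iff₀ hapos]
        have h6 : A / 2 < lam j ^ 2 / ν * ‖a‖ := h2
        rw [div_mul_eq_mul_div, lt_div_iff₀ hν] at h6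
        have hA' : 0 < 2 / A := by positivity
        have h7 := mul_lt_mul_of_pos_left h6 hA'
        have h8 : 2 / A * (A / 2 * ν) = ν := by field_simp
        rw [h8] at h7
        calc ν < 2 / A * (lam j ^ 2 * ‖a‖) := h7
          _ = lam j ^ 2 * (2 / A) * ‖a‖ := by ring
      calc Real.sqrt (ν / ‖a‖) < Real.sqrt (lam j ^ 2 * (2 / A)) := Real.sqrt_lt_sqrt (by positivity) hq
        _ = lam j * K := by rw [Real.sqrt_mul (sq_nonneg (lam j)) (2 / A), Real.sqrt_sq (hlam j).le]
    calc volume (Aset j) = ENNReal.ofReal ((lam j ^ 3)⁻¹) * volume (Phys j) := hvolA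
      _ ≤ ENNReal.ofReal ((lam j ^ 3)⁻¹) * ENNReal.ofReal (δ * Real.sqrt (ν / ‖a‖) ^ 3) := by gcongr
      _ = ENNReal.ofReal ((lam j ^ 3)⁻¹ * (δ * Real.sqrt (ν / ‖a‖) ^ 3)) :=
          (ENNReal.ofReal_mul (inv_nonneg.mpr (pow_nonneg (hlam j).le 3))).symm
      _ ≤ ENNReal.ofReal (V.toReal / 2) := by
          apply ENNReal.ofReal_le_ofReal
          have hl3 : 0 < lam j ^ 3 := pow_pos (hlam j) 3
          have hineq : Real.sqrt (ν / ‖a‖) ^ 3 ≤ (lam j * K) ^ 3 :=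
            pow_le_pow_left₀ (Real.sqrt_nonneg _) hsqrt.le 3
          calc (lam j ^ 3)⁻¹ * (δ * Real.sqrt (ν / ‖a‖) ^ 3)
              ≤ (lam j ^ 3)⁻¹ * (δ * (lam j * K) ^ 3) := by
                apply mul_le_mul_of_nonneg_left _ (inv_nonneg.mpr hl3.le)
                exact mul_le_mul_of_nonneg_left hineq hδ0.le
            _ = δ * K ^ 3 := by
                have hl0 : lam j ≠ 0 := (hlam j).ne'
                field_simp
            _ = V.toReal / 2 := by
                have hK0 : K ≠ 0 := hKpos.ne'
                rw [hδ]; field_simp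
  -- every tail is bounded by one `Aset (max N N₀)`
  have hTailN : ∀ N, volume (Tail N) ≤ ENNReal.ofReal (V.toReal / 2) := by
    intro N
    have hsub : Tail N ⊆ Aset (max N N₀) := by
      intro z hz
      simp only [hTail, mem_iInter] at hz
      exact hz (max N N₀) (le_max_left _ _)
    exact (measure_mono hsub).trans (hAj _ (le_max_right _ _))
  -- continuity from below (no measurability needed) and the contradiction
  have hU : volume (⋃ N, Tail N) = ⨆ N, volume (Tail N) := hTailmono.measure_iUnion
  have hle : V ≤ ENNReal.ofReal (V.toReal / 2) :=
    calc V ≤ volume (⋃ N, Tail N) := measure_mono hball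
      _ = ⨆ N, volume (Tail N) := hU
      _ ≤ ENNReal.ofReal (V.toReal / 2) := iSup_le hTailN
  have hlt : ENNReal.ofReal (V.toReal / 2) < V := by
    calc ENNReal.ofReal (V.toReal / 2) < ENNReal.ofReal V.toReal :=
          (ENNReal.ofReal_lt_ofReal_iff_of_nonneg (by positivity)).mpr (by linarith)
      _ = V := ENNReal.ofReal_toReal hVtop
  exact absurd hle (not_le.mpr hlt)

end Summit.NavierStokesRegularity.NavierStokesRegularity.Theorems

end
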